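import Summits.BirchSwinnertonDyer.BirchSwinnertonDyer.Theses.PrintX10b
import Summits.BirchSwinnertonDyer.BirchSwinnertonDyer.Theorems.PrintX10bAssemblyLightTwinsX10b
import Summits.BirchSwinnertonDyer.BirchSwinnertonDyer.Theorems.PrintX10bPrintMuCGEntry
import Summits.BirchSwinnertonDyer.BirchSwinnertonDyer.Theorems.PrintX10bTwoSidedLinkAnyClassNumberX10bPinnedOfPrint
import Summits.BirchSwinnertonDyer.BirchSwinnertonDyer.Theorems.PrintX10bAnalyticMuZeroX10b
import Summits.BirchSwinnertonDyer.BirchSwinnertonDyer.Theorems.PrintX9MuInequalityCoherentPairOfPrintCG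
import Literature.NumberTheory.EllipticCurves.AnticyclotomicTowerSharpProofs
import HarnessLib

/-!
# T-G (X10b) — DISPLAY: the corner `WAllCornerX10b` from the TEN by-name print leaves only

Turnkey of pen plan g14 (HOME/plan/turnkeys/g14-postclosure/), landed by width seat x10b-p1-w5 g4 AFTER item
stmt-BirchSwinnertonDyer-23428 `MuInequalityCoherentPairOfPrintCG` was CLOSED·proved; the μ-binder hM is discharged BY NAME by the
μ-LEAD's closing theorem `HeegnerMuPartOfPrintCGClosed.muInequalityCoherentPairOfPrintCG_holds_X10b`
(module `Theorems.PrintX9MuInequalityCoherentPairOfPrintCG`).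
Row 10 of the D-0131 print tier in PARTITION currency: the route's deciding theorem `Theses.PrintX10b.closes` (rev 48)
with every CLOSED binder discharged BY NAME — hAsm (27276), hM (23428), hG (23439), hB3 (26624), hA (20682,
hypothesis-free `AnalyticMuZeroX10b_of`) — leaving exactly the ten cite-only print leaves hH hK hCG hMZ hNV hCGS hTw hPT
hHP hP (each a `def … : Prop` typed verbatim from the printed theorem, referee-policed): NO open kernel work remains on
row 10. `#print axioms` must be ⊆ {propext, Classical.choice, Quot.sound}. BSD is NOT proved by this file; no print leaf
is discharged here. Proposal: `ledger propose --kind proof --target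
Summits/BirchSwinnertonDyer/BirchSwinnertonDyer/Theorems/PrintX10bCornerOfPrintLeaves.lean --supports stmt-BirchSwinnertonDyer-23428 --as helper`.
APPEND (x10b-p1-w5 g4, after Tower♯ p681041): `wallCornerX10b_of_nineLeaves` — the same corner from NINE leaves, the
binder hTw `AnticyclotomicTowerSharp` discharged BY NAME by `Literature.NumberTheory.EllipticCurves.anticyclotomicTowerSharp`.
-/

namespace Summit.BirchSwinnertonDyer.BirchSwinnertonDyer.Theorems.PrintX10bCornerOfPrintLeaves

-- `Summit.<Summit>.<Sub>.…` with Summit = Sub (D-0017): the linter flags it by design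
set_option linter.dupNamespace false

open Summit.BirchSwinnertonDyer.BirchSwinnertonDyer.Theses.PrintX10b

/-- Row 10 display: the registered corner `WAllCornerX10b` (⇐ BSD_3 on the X10b leaf `X10.BSDpOnClassX10b`) from the
ten by-name print leaves, every other binder of `PrintX10b.closes` being a kernel theorem. -/
theorem wallCornerX10b_of_printLeaves
    (hH : HowardDVRKolyvaginBound) (hK : CGLSHeegnerKolyvaginSystem) (hCG : CoatesGreenbergKummerImage)
    (hMZ : MastellaZermanHowardDivisibility) (hNV : CGLSHeegnerClassNonvanishing)
    (hCGS : CGSHowardDivisibilityPLocalized) (hTw : AnticyclotomicTowerSharp) (hPT : PinnedTransferPrintFacts)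
    (hHP : HeegnerPrintFactsX10b) (hP : PrintFactsX10b) :
    Summit.BirchSwinnertonDyer.WAllCornerX10b :=
  -- buildfix G32-1 (2026-08-29, class (i) drift): `PrintX10b.closes` was re-keyed (rev ≥ 49, binder hG3
  -- `HowardContainmentLightFrameX10bPinnedOfKSLeaves`); the display keeps its accepted statement and spells the
  -- rev-48 chain directly (the same composition `closes` rev 48 certified), so it no longer depends on `closes`.
  Summit.BirchSwinnertonDyer.Rank1Residual.WAll.wallCornerX10b_of_bsdpOnClassX10b
    (Summit.BirchSwinnertonDyer.BirchSwinnertonDyer.Theorems.PrintX10bAssemblyLightTwinsX10b.assemblyLightTwinsX10b_proof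
      (Summit.BirchSwinnertonDyer.BirchSwinnertonDyer.Theorems.PrintX10bPrintMuCGEntry.howardContainmentLightFrameX10bPinnedOfPrintOfPrintMuCG_holds
        Summit.BirchSwinnertonDyer.BirchSwinnertonDyer.Theorems.HeegnerMuPartOfPrintCGClosed.muInequalityCoherentPairOfPrintCG_holds_X10b
        hH hK hCG hMZ hNV hCGS hTw)
      (Summit.BirchSwinnertonDyer.BirchSwinnertonDyer.Theorems.PrintX10bPinned.twoSidedLinkAnyClassNumberX10bPinnedOfPrint_holds
        hPT hHP)
      hHP
      Summit.BirchSwinnertonDyer.BirchSwinnertonDyer.Cruxes.AnalyticMuZeroX10b.TheoremB.AnalyticMuZeroX10b_of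
      hP)

/-- Row 10 display, NINE leaves (append 2026-08-29, x10b-p1-w5 g4): the registered corner `WAllCornerX10b` from the
nine remaining cite-only print leaves hH hK hCG hMZ hNV hCGS hPT hHP hP — the tenth binder of `PrintX10b.closes`,
`AnticyclotomicTowerSharp` (Tower♯, item stmt-BirchSwinnertonDyer-27076: `K_k ⊆ K[p^{k+1}]` for the anticyclotomic
ℤ_p-extension of an imaginary quadratic field, p odd), is DISCHARGED BY NAME by the unconditional kernel theorem
`Literature.NumberTheory.EllipticCurves.anticyclotomicTowerSharp` (x10b-p1-w2 g12, p681041; class field theory over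
the tree, with x9-p1-w4 g10 p680094 and bsd-line-x10b-p1 LEAD g10 p680687). Display only; BSD is NOT proved here. -/
theorem wallCornerX10b_of_nineLeaves
    (hH : HowardDVRKolyvaginBound) (hK : CGLSHeegnerKolyvaginSystem) (hCG : CoatesGreenbergKummerImage)
    (hMZ : MastellaZermanHowardDivisibility) (hNV : CGLSHeegnerClassNonvanishing)
    (hCGS : CGSHowardDivisibilityPLocalized) (hPT : PinnedTransferPrintFacts)
    (hHP : HeegnerPrintFactsX10b) (hP : PrintFactsX10b) :
    Summit.BirchSwinnertonDyer.WAllCornerX10b :=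
  wallCornerX10b_of_printLeaves hH hK hCG hMZ hNV hCGS
    Literature.NumberTheory.EllipticCurves.anticyclotomicTowerSharp hPT hHP hP

end Summit.BirchSwinnertonDyer.BirchSwinnertonDyer.Theorems.PrintX10bCornerOfPrintLeaves
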